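import Mathlib
import Summits.ValiantsHypothesis.ValiantsHypothesis.Theses.NewtonUnitEquations

/-!
# Sketch — crux-ideate stmt-ValiantsHypothesis-5904 (NewtonTauWeak), ideator 3

First lemmas of two crux idea cards, stated over existing declarations (nothing proved here):

* card `valued-rolle-wronskian` : `ValuedRolle`, `ValuedVoorhoeveKPT`, `PowersFixedK`,
  `PowersWeak`, `powersTransfer` (KPTT Thm 3 direction).
* card `tie-annulus-log-linearisation` : `CompositeFree`, `CompositeFreeLocal`.

`xadicVertexCount F` = number of vertices of the X-adic Newton polygon of `F ∈ ℂ[X][Y]`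
(lower convex hull, in the X-exponent direction, of the support) = 1 + number of distinct
`ord_X`-valuations of the nonzero roots of `F` in `Y` over the Puiseux field (for `F ≠ 0`).
-/

namespace Summit.ValiantsHypothesis.ValiantsHypothesis.Cruxes.NewtonTauWeak.Ideator3

open scoped BigOperators Pointwise

noncomputable section

/-- Embed an exponent vector of `ℂ[X,Y]` into `ℝ²` (coordinate `0` = X-exponent, `1` = Y-exponent). -/
def toPt (e : Fin 2 →₀ ℕ) : Fin 2 → ℝ := fun i => ((e i : ℕ) : ℝ)

/-- Vertices of the Newton polygon (as in the crux `NewtonTauWeak`). -/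
def newtonVertexCount' (F : MvPolynomial (Fin 2) ℂ) : ℕ :=
  (Set.extremePoints ℝ (convexHull ℝ (toPt '' (F.support : Set (Fin 2 →₀ ℕ))))).ncard

/-- Vertices of the X-adic Newton polygon of `F` viewed in `ℂ((X))[Y]`: extreme points of
`conv(supp F) + ℝ_{≥0}·e₀`.  For `F ≠ 0` this is `1 +` the number of distinct `ord_X`-valuations of
the nonzero roots of `F` in `Y` (over the algebraic closure of `ℂ((X))`); these are the edges of
`Newt(F)` whose outer normal has negative X-component. -/
def xadicVertexCount (F : MvPolynomial (Fin 2) ℂ) : ℕ :=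
  (Set.extremePoints ℝ (convexHull ℝ (toPt '' (F.support : Set (Fin 2 →₀ ℕ))) +
    {x : Fin 2 → ℝ | 0 ≤ x 0 ∧ x 1 = 0})).ncard

/-- Vertices of the local Newton polyhedron at the origin: extreme points of
`conv(supp F) + ℝ²_{≥0}` (the compact faces of `Γ₊(F)`). -/
def newtonPolyhedronVertexCount (F : MvPolynomial (Fin 2) ℂ) : ℕ :=
  (Set.extremePoints ℝ (convexHull ℝ (toPt '' (F.support : Set (Fin 2 →₀ ℕ))) +
    {x : Fin 2 → ℝ | 0 ≤ x 0 ∧ 0 ≤ x 1})).ncard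

/-- The `∂/∂Y`-Wronskian of the first `j` of the polynomials `g 0, …, g (k-1)`:
`det [ ∂_Y^r (g s) ]_{r,s < j}`. -/
def wronskianY {k : ℕ} (g : Fin k → MvPolynomial (Fin 2) ℂ) (j : ℕ) (hj : j ≤ k) :
    MvPolynomial (Fin 2) ℂ :=
  Matrix.det (Matrix.of fun r s : Fin j =>
    (fun p : MvPolynomial (Fin 2) ℂ => MvPolynomial.pderiv 1 p)^[r.val] (g (Fin.castLE hj s)))

/-- CARD A, first lemma (valued Rolle–Voorhoeve lemma over `ℂ((X))`, residue characteristic 0):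
for `p, q ∈ ℂ[X][Y]` with nonzero Y-Wronskian `W = p_Y q − p q_Y`, the root-valuation classes of `p`
are bounded by those of `W` and of `q`:  `E(p) ≤ E(W) + 3·E(q) + 2`, written with vertex counts
(`N = E + 1`).  Proof sketch: expand `p/q` in Laurent series on each of the `≤ E(q)+1` annuli free of
roots of `q`; there `|n| = 1` for `n ∈ ℤ ∖ 0` gives `N_{(p/q)'}(ν) = N^×_{p/q}(ν) − ν`, and
`N_{p/q} = min(N^×, v(c₀))` has at most two more breakpoints than `N^×`. -/
def ValuedRolle : Prop :=
  ∀ p q : MvPolynomial (Fin 2) ℂ, q ≠ 0 →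
    MvPolynomial.pderiv 1 p * q - p * MvPolynomial.pderiv 1 q ≠ 0 →
    xadicVertexCount p ≤
      xadicVertexCount (MvPolynomial.pderiv 1 p * q - p * MvPolynomial.pderiv 1 q)
        + 3 * xadicVertexCount q + 3

/-- CARD A, second lemma (valued Voorhoeve–van der Poorten / KPT inequality): by the induction of
Koiran–Portier–Tavenas' real Wronskian theorem run with `ValuedRolle` in place of Rolle's theorem,
the root-valuation classes of `g₀ + ⋯ + g_{k-1}` are bounded by those of the Wronskian flag
`W₁, …, W_k` (constants depending on `k` only). -/
def ValuedVoorhoeveKPT : Prop :=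
  ∀ k : ℕ, ∃ A B : ℕ, ∀ g : Fin k → MvPolynomial (Fin 2) ℂ,
    (∀ (j : ℕ) (hj : j ≤ k), 1 ≤ j → wronskianY g j hj ≠ 0) →
    xadicVertexCount (∑ i, g i) ≤
      A * (∑ j : Fin (k + 1), xadicVertexCount (wronskianY g j.val (Nat.lt_succ_iff.mp j.isLt))) + B

/-- CARD A, the rung it proves (modulo the two lemmas and the monomial count of generalised
Wronskians of powers, which is independent of `m`): for every fixed `k`, the Newton polygon of a
sum of `k` `m`-th powers of `t`-sparse bivariate polynomials has `≤ C_k (t+2)^{c_k}` vertices,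
uniformly in `m`. -/
def PowersFixedK : Prop :=
  ∀ k : ℕ, ∃ C c : ℕ, ∀ (m t : ℕ) (a : Fin k → ℂ) (f : Fin k → MvPolynomial (Fin 2) ℂ),
    (∀ i, (f i).support.card ≤ t) →
    newtonVertexCount' (∑ i, MvPolynomial.C (a i) * f i ^ m) ≤ C * (t + 2) ^ c

/-- CARD A, transfer target `C⁺` = the sums-of-powers form of the weak Newton-polygon τ-conjecture
(KPTT 2015, Thm 3): equivalent to `NewtonTauWeak` up to constants (Fischer's formula), and the form
in which Wronskians factor. -/
def PowersWeak : Prop :=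
  ∃ a b : ℕ, ∀ (k m t : ℕ) (c : Fin k → ℂ) (f : Fin k → MvPolynomial (Fin 2) ℂ),
    (∀ i, (f i).support.card ≤ t) →
    newtonVertexCount' (∑ i, MvPolynomial.C (c i) * f i ^ m) ≤ 2 ^ (a * m) * (k * t + 2) ^ b

/-- KPTT Theorem 3 (direction used): the powers form implies the crux (Fischer's formula writes a
product of `m` factors as a signed sum of `2^{m-1}` `m`-th powers of `(mt)`-sparse polynomials). -/
def powersTransfer : Prop :=
  PowersWeak → Summit.ValiantsHypothesis.ValiantsHypothesis.Theses.NewtonUnitEquations.NewtonTauWeak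

/-- CARD B: the exponent-genericity hypothesis "composite-free" for a family of generator sets
`G i ⊂ ℕ²` (the supports of the `uⱼ` and `vⱼ` in a log chart): no word of length `≥ 2` in the
generators of ONE set represents a point that is also a generator of some set or another word
(length `≥ 1`) of some set, unless it is the same word of the same set.  (Bare generators may be
shared by several sets — that is where cancellation is allowed to happen.) -/
def CompositeFree {ι : Type} (G : ι → Finset (Fin 2 →₀ ℕ)) : Prop :=
  ∀ (i i' : ι) (n n' : (Fin 2 →₀ ℕ) →₀ ℕ),
    n.support ⊆ G i → n'.support ⊆ G i' →
    2 ≤ n.sum (fun _ k => k) → 1 ≤ n'.sum (fun _ k => k) →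
    n.sum (fun γ k => k • γ) = n'.sum (fun γ k => k • γ) → (i = i' ∧ n = n')

/-- CARD B, first lemma (composite-free log charts have few vertices): in the local Newton
polyhedron at the origin of `∏ⱼ (1 + uⱼ) − ∏ⱼ (1 + vⱼ)` (`uⱼ, vⱼ` without constant term, `≤ t`
monomials each) — which equals that of the formal series `Δ = Σⱼ log(1+uⱼ) − Σⱼ log(1+vⱼ)` —
every vertex is, under `CompositeFree`, either a surviving generator (a support point of some
`uⱼ` or `vⱼ`) or a word of length exactly 2 in CANCELLED generators of one factor; hence at most
`2mt + 2mt²` vertices, for every choice of coefficients.  (Proof on paper: `log(1+u)` has the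
nonzero universal coefficients `(−1)^{|n|+1}(|n|−1)!/n!` on the words; a composite with a surviving
constituent, or of length `≥ 3`, is a midpoint inside the polyhedron.) -/
def CompositeFreeLocal : Prop :=
  ∀ (m t : ℕ) (u v : Fin m → MvPolynomial (Fin 2) ℂ),
    (∀ j, MvPolynomial.coeff 0 (u j) = 0 ∧ (u j).support.card ≤ t) →
    (∀ j, MvPolynomial.coeff 0 (v j) = 0 ∧ (v j).support.card ≤ t) →
    CompositeFree (Sum.elim (fun j => (u j).support) (fun j => (v j).support)) →
    newtonPolyhedronVertexCount (∏ j, (1 + u j) - ∏ j, (1 + v j)) ≤ 4 * m * t ^ 2 + 1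

end

end Summit.ValiantsHypothesis.ValiantsHypothesis.Cruxes.NewtonTauWeak.Ideator3
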